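import Summits.Langlands.Langlands.Theorems.IrreducibilityBySelfDualityPairLBoundaryJSGapUnitBoxLocalValue

/-!
# Crux `PairLBoundaryJS` (stmt-Langlands-13622), line `Sketch` — stub `stub_gap_unitBox_productForm` (G-PF),
# part 2: the `GL_n × GL_m` support theorem at one place, and peeling the bad places off the pair

Summit `Langlands`, sub-problem `Langlands`, helper file under `Theorems/` supporting the crux
`PairLBoundaryJS` (Arthur–Clozel (1989), Ch. 3, (2.2)), line `Sketch`, registered stub
`stub_gap_unitBox_productForm` (proved in `…PairLBoundaryJSGapUnitBoxProductForm`, which imports this file;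
part 1 is `…GapUnitBoxLocalValue`); this file proves the registered sub-goal `stub_gap_unitBox_support`. This is
the `GL_n × GL_m` (`m ≤ n - 1`) generalisation of the corner file `…CornerUnitBoxPeel` (`GL_{m+1} × GL_m`).

Bookkeeping for the bad-place step of the Rankin–Selberg method for the pair `GL_n × GL_m`
(Jacquet–Piatetski-Shapiro–Shalika (1983), §2, (2.7); Cogdell (2004), §4.1, `Ψ = ∏_v Ψ_v`), `ι = diag(·, 1_{n-m})`:

* `glCorner_glDiagonal` — `ι(diag a) = diag(a, 1, …, 1)`;
* `valued_eq_one_of_gap_ne_zero` (= `stub_gap_unitBox_support`) — **the support theorem at one place**: for `W`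
  on `GL_n(𝔸_K)` left `ψ`-equivariant, central up to modulus one and spread at `v` (NO depth hypothesis),
  `W(G ι(diag(a) k)) ≠ 0` at a base point `G` with trivial `v`-component forces `|a_{i,v}| = 1`: the `v`-component of
  `ι(diag(a) k)` is `diag(a_v, 1) · ι(k_v)` with `ι(k_v) ∈ GL_n(𝒪_v)` of last row EXACTLY `e_n`, so the torus form
  of the support theorem (`WhittakerSupport.valuation_eq_of_glDiagonal_mul_ne_zero`, at a depth below the level,
  `exists_nat_exp_neg_mul_le`) gives `|a_{i,v}| = |1|_v`;
* `glCorner_mem_principalCongruenceLevel`, `apply_mul_glCorner_ofFinite` — `ι(K_m(𝔫)) ≤ K_n(𝔫)`, so `W ∘ ι` is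
  right `K_f(𝔫)`-invariant when `W` is; `glCorner_ofInfinite` — `ι((h, 1)) = ((ι h), 1)`;
* `gap_pair_eq_prod_mul_pair` — **peeling the places of `S ⊆ T` off `W(ι g) W̄'(g)`**: the `GL_n × GL_m` version of
  `CornerUnitBoxProductForm.corner_pair_eq_prod_mul_pair` (induction on `S`, no last-row hypothesis).

All proofs complete; tree theorems only.

## References

* H. Jacquet, I. I. Piatetski-Shapiro, J. A. Shalika, *Rankin–Selberg convolutions*, Amer. J. Math.
  105 (1983), §2, (2.7) [JacquetPiatetskiShapiroShalika1983].
* J. W. Cogdell, *Analytic theory of L-functions for GL_n*, in *An Introduction to the Langlands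
  Program* (2004), §2.3, §4.1 [CogdellAnalyticTheory2004].
-/

noncomputable section

-- `Summit.Langlands.Langlands.…` (summit = sub-problem name, D-0017 layout) trips `dupNamespace`
set_option linter.dupNamespace false

open scoped MatrixGroups Topology Pointwise ENNReal NNReal ComplexConjugate InnerProductSpace ContDiff
-- the place subtypes indexing `mixedSpace K` are `Fintype` classically (`NormedCommRing (mixedSpace K)`)
open scoped Classical Matrix.Norms.Operator
open NumberField IsDedekindDomain MeasureTheory Measure Matrix Set Filter WithZero
open NumberField.mixedEmbedding
open Literature.NumberTheory.Automorphic AdelicGroupData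
open Literature.NumberTheory.GaloisRepresentations (ideleGroup HeckeCharacter)
open ValuativeRel

-- no local instances needed in this file (pointwise statements only)

namespace Summit.Langlands.Langlands.Theorems.GapUnitBoxProductForm

/-! ### Corners of diagonal matrices -/

section Diagonal

variable {m n : ℕ}

/-- **`diag(diag(d), 1_{n-m}) = diag(d')`** with `d'_i = d_i` for `i < m` and `d'_i = 1` for `i ≥ m`. [folklore] -/
theorem glCorner_glDiagonal {R : Type*} [CommRing R] (h : m ≤ n) (d : Fin m → Rˣ) :
    glCorner R h (glDiagonal m R d) = glDiagonal n R (fun i => if hi : (i : ℕ) < m then d ⟨i, hi⟩ else 1) := by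
  refine Matrix.GeneralLinearGroup.ext fun i j => ?_
  rw [glCorner_apply_val, coe_glDiagonal, coe_glDiagonal, Matrix.diagonal_apply]
  by_cases hi : (i : ℕ) < m <;> by_cases hj : (j : ℕ) < m
  · rw [dif_pos hi, dif_pos hj, Matrix.diagonal_apply]
    by_cases hij : i = j
    · subst hij
      rw [if_pos rfl, if_pos rfl, dif_pos hi]
    · have hij' : (⟨i, hi⟩ : Fin m) ≠ ⟨j, hj⟩ := fun h => hij (Fin.ext (Fin.mk.inj_iff.mp h))
      rw [if_neg hij', if_neg hij]
  · have hij : i ≠ j := fun h => hj (h ▸ hi)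
    rw [dif_pos hi, dif_neg hj, if_neg hij]
  · have hij : i ≠ j := fun h => hi (h ▸ hj)
    rw [dif_neg hi, if_pos hj, if_neg hij]
  · rw [dif_neg hi, if_neg hj]
    by_cases hij : i = j
    · subst hij
      rw [if_pos rfl, if_pos rfl, dif_neg hi, Units.val_one]
    · rw [if_neg hij, if_neg hij]

end Diagonal

/-! ### The `GL_n × GL_m` support theorem at one bad place -/

section Support

variable {m n : ℕ} {K : Type} [Field K] [NumberField K] {v : HeightOneSpectrum (𝓞 K)}
  {ψ : AddChar (AdeleRing (𝓞 K) K) Circle} {W : GL (Fin (n + 1)) (AdeleRing (𝓞 K) K) → ℂ}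
  {t : Fin (n + 1) → (v.adicCompletion K)ˣ} {M c₀ : ℤ}

/-- **The `GL_{n+1} × GL_m` support theorem at one place** (`m ≤ n`). Let `W : GL_{n+1}(𝔸_K) → ℂ` be left
`ψ`-equivariant, with `‖W(z g)‖ = ‖W(g)‖` for scalar ideles `z`, and spread at `v` (`IsSpreadWhittakerAt v ψ t M W`,
`ψ_v` non-trivial on `{|y| ≤ exp(1 - c₀)}`, `M ≥ 1`, monotone `|t_i|` with gaps — NO depth hypothesis). If
`W(G · diag(diag(a) k, 1_{n+1-m})) ≠ 0` for a base point `G` with trivial `v`-component, `a ∈ (𝔸_Kˣ)ᵐ` and `k` in the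
maximal compact subgroup, then every `a_i` is a unit at `v`: the `v`-component of `diag(diag(a) k, 1)` is
`diag(a_v, 1) · diag(k_v, 1)` (`glCorner_glDiagonal`) with `diag(k_v, 1) ∈ GL_{n+1}(𝒪_v)` of last row EXACTLY
`e_{n+1}` (`glCorner_last_apply`), so the torus form of the support theorem
(`WhittakerSupport.valuation_eq_of_glDiagonal_mul_ne_zero`, at any depth below the level) gives
`|a_{i,v}| = |1|_v = 1`. [folklore] -/
theorem valued_eq_one_of_gap_ne_zero (h : m ≤ n + 1) (hm : m ≤ n)
    (hWN : ∀ (u : ↥(adelicUnipotent (n + 1) K)) (g : GL (Fin (n + 1)) (AdeleRing (𝓞 K) K)),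
      W ((u : GL (Fin (n + 1)) (AdeleRing (𝓞 K) K)) * g) = whittakerCharFun ψ u * W g)
    (hWZ : ∀ (z : ideleGroup K) (g : GL (Fin (n + 1)) (AdeleRing (𝓞 K) K)),
      ‖W (Matrix.GeneralLinearGroup.scalar (Fin (n + 1)) z * g)‖ = ‖W g‖)
    (hW : IsSpreadWhittakerAt v ψ t M W)
    (hψv : ∃ y : v.adicCompletion K, Valued.v y ≤ exp (1 - c₀) ∧ ψ.adicComponent v y ≠ 1) (hM₁ : 1 ≤ M)
    (hmono : ∀ i j : Fin (n + 1), i ≤ j → Valued.v (t j : v.adicCompletion K) ≤ Valued.v (t i : v.adicCompletion K))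
    (hgap : ∀ i j : Fin (n + 1), (i : ℕ) + 1 = j →
      exp (M - c₀) * Valued.v (t j : v.adicCompletion K) ≤ Valued.v (t i : v.adicCompletion K))
    {G : GL (Fin (n + 1)) (AdeleRing (𝓞 K) K)} (hG : localComponent v G = 1)
    (a : Fin m → ideleGroup K) (k : ↥(maximalCompactAdelic m K))
    (hne : W (G * glCorner (AdeleRing (𝓞 K) K) h (torusPoint m K (a, k))) ≠ 0) (i : Fin m) :
    Valued.v (((a i : ideleGroup K) : AdeleRing (𝓞 K) K).2 v) = 1 := by
  -- a depth below the level
  obtain ⟨N, hN⟩ := CornerUnitBoxProductForm.exists_nat_exp_neg_mul_le (a := Valued.v (t 0 : v.adicCompletion K))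
    ((Valuation.ne_zero_iff _).2 (t (Fin.last n)).ne_zero) M
  -- the `v`-component of the corner torus point: `diag(a_v, 1) · diag(k_v, 1)`
  set kv : GL (Fin m) (v.adicCompletion K) :=
    localComponent v (show GL (Fin m) (AdeleRing (𝓞 K) K) from (k : (AdelicGroupData.gl m K).Adelic)) with hkv
  set a' : Fin (n + 1) → ideleGroup K := fun l => if hl : (l : ℕ) < m then a ⟨l, hl⟩ else 1 with ha'
  set av : Fin (n + 1) → (v.adicCompletion K)ˣ := fun l =>
    Units.map (AdelicGroupData.adeleEval K v : AdeleRing (𝓞 K) K →+* v.adicCompletion K).toMonoidHom (a' l) with hav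
  set tp : GL (Fin (n + 1)) (AdeleRing (𝓞 K) K) := glCorner (AdeleRing (𝓞 K) K) h (torusPoint m K (a, k)) with htp
  have htpv : localComponent v tp =
      glDiagonal (n + 1) (v.adicCompletion K) av * glCorner (v.adicCompletion K) h kv := by
    rw [htp, torusPoint, map_mul, glCorner_glDiagonal, UnitBoxTranslateProductForm.localComponent_mul,
      CornerPairTranslate.localComponent_glCorner]
    congr 1
    exact generalLinearGroup_map_glDiagonal _ _
  set g : GL (Fin (n + 1)) (AdeleRing (𝓞 K) K) := G * tp with hg
  have hgv : localComponent v g = localComponent v tp := by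
    rw [hg, UnitBoxTranslateProductForm.localComponent_mul, hG, one_mul]
  set g' : GL (Fin (n + 1)) (AdeleRing (𝓞 K) K) := g * GLn.ofLocal (n + 1) K v (localComponent v g)⁻¹ with hg'
  have hg'1 : localComponent v g' = 1 := localComponent_mul_ofLocal_inv g
  have hWloc : WhittakerSupport.IsSpreadWhittaker (ψ.adicComponent v) t M
      (fun x => W (g' * GLn.ofLocal (n + 1) K v x)) := isSpreadWhittaker_ofLocal hWN hW hg'1
  have hcent : ∀ (z : (v.adicCompletion K)ˣ) (x : GL (Fin (n + 1)) (v.adicCompletion K)),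
      W (g' * GLn.ofLocal (n + 1) K v x) ≠ 0 →
        W (g' * GLn.ofLocal (n + 1) K v (glDiagonal (n + 1) (v.adicCompletion K) (fun _ => z) * x)) ≠ 0 :=
    fun z x hz => ofLocal_scalar_ne_zero hWZ g' z x hz
  have hne' : W (g' * GLn.ofLocal (n + 1) K v
      (glDiagonal (n + 1) (v.adicCompletion K) av * glCorner (v.adicCompletion K) h kv)) ≠ 0 := by
    rw [← htpv, ← hgv, hg', mul_assoc, ← map_mul, inv_mul_cancel, map_one, mul_one]
    exact hne
  have hkv1 : glCorner (v.adicCompletion K) h kv ∈ valuedCongruenceSubgroup (Fin (n + 1)) (1 : ℤᵐ⁰) := by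
    rw [glCorner_mem_valuedCongruenceSubgroup_iff h, ← glInt_adicCompletion_eq]
    exact localComponent_mem_glInt_of_mem_maximalCompactAdelic k.2
  have hlast : ∀ j : Fin (n + 1), j ≠ Fin.last n →
      Valued.v (((glCorner (v.adicCompletion K) h kv : GL (Fin (n + 1)) (v.adicCompletion K)) :
        Matrix (Fin (n + 1)) (Fin (n + 1)) (v.adicCompletion K)) (Fin.last n) j) ≤ exp (-(N : ℤ)) := fun j hj => by
    rw [glCorner_last_apply h hm, if_neg hj, Valuation.map_zero]
    exact zero_le
  have hv := WhittakerSupport.valuation_eq_of_glDiagonal_mul_ne_zero (ψ.adicComponent v) hψv hM₁ hmono hgap hWloc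
    hcent hN av hkv1 hlast hne' (Fin.castLE h i)
  have ha'_i : a' (Fin.castLE h i) = a i := by
    simp only [ha', Fin.val_castLE, Fin.is_lt, ↓reduceDIte, Fin.eta]
  have hav_i : ((av (Fin.castLE h i) : (v.adicCompletion K)ˣ) : v.adicCompletion K) =
      ((a i : ideleGroup K) : AdeleRing (𝓞 K) K).2 v := by
    simp only [hav, ha'_i]
    rfl
  have ha'_last : a' (Fin.last n) = 1 := by
    simp only [ha']
    rw [dif_neg (by rw [Fin.val_last]; omega)]
  have hav_last : av (Fin.last n) = 1 := by simp only [hav, ha'_last, map_one]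
  rw [hav_last, Units.val_one, Valuation.map_one, hav_i] at hv
  exact hv

end Support

/-! ### The corner against the levels and the archimedean embedding -/

section Glue

variable {m N : ℕ} {K : Type} [Field K] [NumberField K]

/-- **`ι(K_m(𝔫)) ≤ K_n(𝔫)`**: `K(𝔫)` is defined place by place (`mem_principalCongruenceLevel_iff_forall_toLocal`)
and `diag(·, 1_{n-m})` preserves the local congruence subgroups (`glCorner_mem_valuedCongruenceSubgroup_iff`).
[folklore] -/
theorem glCorner_mem_principalCongruenceLevel (h : m ≤ N) {𝔫 : Ideal (𝓞 K)} {g : GL (Fin m) (AdeleRing (𝓞 K) K)}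
    (hg : g ∈ principalCongruenceLevel m K 𝔫) :
    glCorner (AdeleRing (𝓞 K) K) h g ∈ principalCongruenceLevel N K 𝔫 := by
  rw [mem_principalCongruenceLevel_iff_forall_toLocal] at hg ⊢
  refine ⟨by rw [GLn.fstHom_glCorner, hg.1, map_one], fun w => ?_⟩
  change localComponent w (glCorner (AdeleRing (𝓞 K) K) h g) ∈ _
  rw [CornerPairTranslate.localComponent_glCorner]
  exact (glCorner_mem_valuedCongruenceSubgroup_iff h _).2 (hg.2 w)

/-- **`W ∘ ι` is right `K_f(𝔫)`-invariant when `W` is**: `W(G ι((1, u))) = W(G)` for `u ∈ K_{m,f}(𝔫)`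
(`ι((1, u)) = (1, u') ∈ K_n(𝔫)`, `GLn.ofFinite_sndHom_of_mem`). [folklore] -/
theorem apply_mul_glCorner_ofFinite (h : m ≤ N) {W : GL (Fin N) (AdeleRing (𝓞 K) K) → ℂ} {𝔫 : Ideal (𝓞 K)}
    (hWK : ∀ u ∈ finitePrincipalCongruenceLevel N K 𝔫, ∀ g : GL (Fin N) (AdeleRing (𝓞 K) K),
      W (g * GLn.ofFinite N K u) = W g)
    {u : GL (Fin m) (FiniteAdeleRing (𝓞 K) K)} (hu : u ∈ finitePrincipalCongruenceLevel m K 𝔫)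
    (G : GL (Fin N) (AdeleRing (𝓞 K) K)) :
    W (G * glCorner (AdeleRing (𝓞 K) K) h (GLn.ofFinite m K u)) = W G := by
  have hU : glCorner (AdeleRing (𝓞 K) K) h (GLn.ofFinite m K u) ∈ principalCongruenceLevel N K 𝔫 :=
    glCorner_mem_principalCongruenceLevel h (mem_finitePrincipalCongruenceLevel_iff.1 hu)
  have hof : GLn.ofFinite N K (GLn.sndHom N K (glCorner (AdeleRing (𝓞 K) K) h (GLn.ofFinite m K u))) =
      glCorner (AdeleRing (𝓞 K) K) h (GLn.ofFinite m K u) :=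
    GLn.ofFinite_sndHom_of_mem (principalCongruenceLevel_le N K 𝔫 hU)
  have hfin : GLn.sndHom N K (glCorner (AdeleRing (𝓞 K) K) h (GLn.ofFinite m K u)) ∈
      finitePrincipalCongruenceLevel N K 𝔫 := by
    rw [mem_finitePrincipalCongruenceLevel_iff, hof]
    exact hU
  rw [← hof]
  exact hWK _ hfin G

/-- **`ι` commutes with the archimedean embedding**: `diag((x, 1), 1_{n-m}) = ((diag(x, 1_{n-m})), 1)` (compare the
archimedean and finite parts, `GLn.ext_of_fstHom_of_sndHom`). [folklore] -/
theorem glCorner_ofInfinite (h : m ≤ N) (x : GL (Fin m) (mixedSpace K)) :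
    glCorner (AdeleRing (𝓞 K) K) h (GLn.ofInfinite m K x) = GLn.ofInfinite N K (glCorner (mixedSpace K) h x) := by
  refine GLn.ext_of_fstHom_of_sndHom ?_ ?_
  · rw [GLn.fstHom_glCorner, GLn.fstHom_ofInfinite, GLn.fstHom_ofInfinite, MulEquiv.eq_symm_apply,
      GLn.infiniteEquivMixed_eq_map, glCorner_map, ← GLn.infiniteEquivMixed_eq_map, MulEquiv.apply_symm_apply]
  · rw [GLn.sndHom_glCorner, GLn.sndHom_ofInfinite, GLn.sndHom_ofInfinite, map_one]

end Glue

/-! ### Peeling the bad places off the `GL_n × GL_m` pair -/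

section Peel

variable {m N : ℕ} {K : Type} [Field K] [NumberField K]

/-- **Peeling the places of `S ⊆ T` off the pair `W(ι g) W̄'(g)`** (`ι = diag(·, 1_{n-m})`). Let `W` on
`GL_n(𝔸_K)` and `W'` on `GL_m(𝔸_K)` be right `K_f(𝔫)`-invariant with the primes of `𝔫` in `T`, and suppose that at
every `v ∈ T` the value `W(ι(g' ι_v(x))) W̄'(g' ι_v(x))` at a base point `g' ∈ GL_m(𝔸_K)` with trivial `v`-component and
ANY `x ∈ GL_m(K_v)` is `J_v(x) W(ι g') W̄'(g')`. Then for `g`, `g'` with the same archimedean part, `g'` trivial at `S`,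
`g = g'` at the places of `T` off `S` and `g'_w⁻¹ g_w ∈ GL_m(𝒪_w)` off `T`:
`W(ι g) W̄'(g) = (∏_{v ∈ S} J_v(g_v)) W(ι g') W̄'(g')` (induction on `S`; the base case is right `K_f(𝔫)`-invariance,
`apply_mul_glCorner_ofFinite`). [folklore] -/
theorem gap_pair_eq_prod_mul_pair (h : m ≤ N) {W : GL (Fin N) (AdeleRing (𝓞 K) K) → ℂ}
    {W' : GL (Fin m) (AdeleRing (𝓞 K) K) → ℂ} {𝔫 : Ideal (𝓞 K)} (h𝔫 : 𝔫 ≠ 0)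
    (hWK : ∀ u ∈ finitePrincipalCongruenceLevel N K 𝔫, ∀ g : GL (Fin N) (AdeleRing (𝓞 K) K),
      W (g * GLn.ofFinite N K u) = W g)
    (hW'K : ∀ u ∈ finitePrincipalCongruenceLevel m K 𝔫, ∀ g : GL (Fin m) (AdeleRing (𝓞 K) K),
      W' (g * GLn.ofFinite m K u) = W' g)
    {T : Finset (HeightOneSpectrum (𝓞 K))} (hT : ∀ w : HeightOneSpectrum (𝓞 K), w.asIdeal ∣ 𝔫 → w ∈ T)
    (J : (v : HeightOneSpectrum (𝓞 K)) → GL (Fin m) (v.adicCompletion K) → ℂ)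
    (hJ : ∀ v ∈ T, ∀ g' : GL (Fin m) (AdeleRing (𝓞 K) K), localComponent v g' = 1 →
      ∀ x : GL (Fin m) (v.adicCompletion K),
        W (glCorner (AdeleRing (𝓞 K) K) h (g' * GLn.ofLocal m K v x)) * star (W' (g' * GLn.ofLocal m K v x)) =
          J v x * (W (glCorner (AdeleRing (𝓞 K) K) h g') * star (W' g'))) :
    ∀ S : Finset (HeightOneSpectrum (𝓞 K)), S ⊆ T → ∀ g g' : GL (Fin m) (AdeleRing (𝓞 K) K),
      (∀ v ∈ S, localComponent v g' = 1) →
      (∀ w, w ∉ S → w ∈ T → localComponent w g = localComponent w g') →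
      (∀ w, w ∉ T → (localComponent w g')⁻¹ * localComponent w g ∈
        valuedCongruenceSubgroup (Fin m) (1 : ℤᵐ⁰)) →
      GLn.fstHom m K g = GLn.fstHom m K g' →
      W (glCorner (AdeleRing (𝓞 K) K) h g) * star (W' g) =
        (∏ v ∈ S, J v (localComponent v g)) * (W (glCorner (AdeleRing (𝓞 K) K) h g') * star (W' g')) := by
  intro S
  induction S using Finset.induction_on with
  | empty =>
    intro _ g g' _ h2 h3 h4
    rw [Finset.prod_empty, one_mul]
    -- `g'⁻¹ g ∈ K(𝔫)`, place by place
    have hu₀ : g'⁻¹ * g ∈ principalCongruenceLevel m K 𝔫 := by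
      rw [mem_principalCongruenceLevel_iff_forall_toLocal]
      refine ⟨by rw [map_mul, map_inv, h4, inv_mul_cancel], fun w => ?_⟩
      change localComponent w (g'⁻¹ * g) ∈ valuedCongruenceSubgroup (Fin m) (idealRadius K w 𝔫)
      rw [UnitBoxTranslateProductForm.localComponent_mul, UnitBoxTranslateProductForm.localComponent_inv]
      by_cases hwT : w ∈ T
      · rw [h2 w (Finset.notMem_empty w) hwT, inv_mul_cancel]
        exact one_mem _
      · rw [idealRadius_eq_one_of_not_dvd h𝔫 (fun h => hwT (hT w h))]
        exact h3 w hwT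
    have hint : g'⁻¹ * g ∈ glIntegralLevel m K := principalCongruenceLevel_le m K 𝔫 hu₀
    have hof : GLn.ofFinite m K (GLn.sndHom m K (g'⁻¹ * g)) = g'⁻¹ * g := GLn.ofFinite_sndHom_of_mem hint
    have hfin : GLn.sndHom m K (g'⁻¹ * g) ∈ finitePrincipalCongruenceLevel m K 𝔫 := by
      rw [mem_finitePrincipalCongruenceLevel_iff, hof]
      exact hu₀
    have hg : g = g' * GLn.ofFinite m K (GLn.sndHom m K (g'⁻¹ * g)) := by rw [hof, mul_inv_cancel_left]
    rw [hg, map_mul, apply_mul_glCorner_ofFinite h hWK hfin, hW'K _ hfin]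
  | insert v S hvS ih =>
    intro hST g g' h1 h2 h3 h4
    have hvT : v ∈ T := hST (Finset.mem_insert_self v S)
    -- move the `v`-component of `g` onto the base point
    set g'' : GL (Fin m) (AdeleRing (𝓞 K) K) := g' * GLn.ofLocal m K v (localComponent v g) with hg''
    have hloc : ∀ w, localComponent w g'' =
        localComponent w g' * localComponent w (GLn.ofLocal m K v (localComponent v g)) := fun w => by
      rw [hg'', UnitBoxTranslateProductForm.localComponent_mul]
    have key := ih ((Finset.subset_insert v S).trans hST) g g'' ?_ ?_ ?_ ?_
    · rw [key, Finset.prod_insert hvS, hg'', hJ v hvT g' (h1 v (Finset.mem_insert_self v S)) (localComponent v g)]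
      ring
    · intro w hw
      have hwv : w ≠ v := fun h => hvS (h ▸ hw)
      rw [hloc, h1 w (Finset.mem_insert_of_mem hw), one_mul, UnitBoxTranslateProductForm.localComponent_ofLocal_of_ne hwv]
    · intro w hwS hwT
      by_cases hwv : w = v
      · subst hwv
        rw [hloc, h1 w (Finset.mem_insert_self w S), one_mul, UnitBoxTranslateProductForm.localComponent_ofLocal_self]
      · rw [hloc, UnitBoxTranslateProductForm.localComponent_ofLocal_of_ne hwv, mul_one]
        exact h2 w (fun h => (Finset.mem_insert.1 h).elim hwv hwS) hwT
    · intro w hwT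
      have hwv : w ≠ v := fun h => hwT (h ▸ hvT)
      rw [hloc, UnitBoxTranslateProductForm.localComponent_ofLocal_of_ne hwv, mul_one]
      exact h3 w hwT
    · rw [hg'', map_mul, GLn.fstHom_ofLocal, mul_one, h4]

end Peel

/-! ### The registered sub-goal: the `GL_n × GL_m` support theorem at one place -/

section SubGoal

/-- **SUB-GOAL (G-PF, part 2) — the `GL_{n+1} × GL_m` support theorem at one bad place** (`m ≤ n`), `∀`-form of
`valued_eq_one_of_gap_ne_zero`: for `W` on `GL_{n+1}(𝔸_K)` left `ψ`-equivariant, central up to modulus one and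
spread at `v` (no depth hypothesis), a base point `G` with trivial `v`-component, `a ∈ (𝔸_Kˣ)ᵐ` and `k` in the
maximal compact subgroup: `W(G · diag(diag(a) k, 1_{n+1-m})) ≠ 0` forces `|a_{i,v}| = 1` for every `i`
(Jacquet–Piatetski-Shapiro–Shalika (1983), (2.7)). [folklore] -/
theorem stub_gap_unitBox_support :
    ∀ {m n : ℕ} {K : Type} [Field K] [NumberField K] {v : HeightOneSpectrum (𝓞 K)} {ψ : AddChar (AdeleRing (𝓞 K) K) Circle}
      {W : GL (Fin (n + 1)) (AdeleRing (𝓞 K) K) → ℂ} {t : Fin (n + 1) → (v.adicCompletion K)ˣ} {M c₀ : ℤ}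
      (h : m ≤ n + 1) (_ : m ≤ n)
      (_ : ∀ (u : ↥(adelicUnipotent (n + 1) K)) (g : GL (Fin (n + 1)) (AdeleRing (𝓞 K) K)), W ((u : GL (Fin (n + 1)) (AdeleRing (𝓞 K) K)) * g) = whittakerCharFun ψ u * W g)
      (_ : ∀ (z : ideleGroup K) (g : GL (Fin (n + 1)) (AdeleRing (𝓞 K) K)), ‖W (Matrix.GeneralLinearGroup.scalar (Fin (n + 1)) z * g)‖ = ‖W g‖)
      (_ : IsSpreadWhittakerAt v ψ t M W) (_ : ∃ y : v.adicCompletion K, Valued.v y ≤ exp (1 - c₀) ∧ ψ.adicComponent v y ≠ 1) (_ : 1 ≤ M)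
      (_ : ∀ i j : Fin (n + 1), i ≤ j → Valued.v (t j : v.adicCompletion K) ≤ Valued.v (t i : v.adicCompletion K))
      (_ : ∀ i j : Fin (n + 1), (i : ℕ) + 1 = j → exp (M - c₀) * Valued.v (t j : v.adicCompletion K) ≤ Valued.v (t i : v.adicCompletion K))
      {G : GL (Fin (n + 1)) (AdeleRing (𝓞 K) K)} (_ : localComponent v G = 1)
      (a : Fin m → ideleGroup K) (k : ↥(maximalCompactAdelic m K))
      (_ : W (G * glCorner (AdeleRing (𝓞 K) K) h (torusPoint m K (a, k))) ≠ 0) (i : Fin m),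
    Valued.v (((a i : ideleGroup K) : AdeleRing (𝓞 K) K).2 v) = 1 := by
  intro m n K _ _ v ψ W t M c₀ h hm hWN hWZ hW hψv hM₁ hmono hgap G hG a k hne i
  exact valued_eq_one_of_gap_ne_zero h hm hWN hWZ hW hψv hM₁ hmono hgap hG a k hne i

end SubGoal

end Summit.Langlands.Langlands.Theorems.GapUnitBoxProductForm
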